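import Summits.BirchSwinnertonDyer.Rank1Residual.SmallImageMu.TeichOrbitNonConstancy
import Summits.BirchSwinnertonDyer.BirchSwinnertonDyer.Theorems.Rank1ResidualX9MuTransfer
import HarnessLib
import HarnessLib.Audit

/-!
# Kernel glue for the carrier node `TeichOrbitNonConstancyOnClassX9` (AN-1): scope, and the two-way
# bookkeeping with item 19630 modulo the PAPER bridges AN-S1 / AN-S2 (taken as explicit hypotheses)

HONEST FRAMING (cell `bsd-f3-mu`).  THEOREMS ONLY, sorry-free; nothing booked.  AN-S1 («non-constancy ⟹
a unit coefficient of `L_p(f,α)`») and AN-S2 (the converse), both at `p ≥ 5` good ordinary with `E[p]`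
irreducible, are Mazur–Tate–Teitelbaum (10.1)–(10.2) + the `p`-integrality of `[·]⁺_f` (Greenberg–Vatsal
2000 §3) + «`μ(L_p) = 0` ⟺ some Riemann sum `ν_n(a)` is a unit»; they are PRINT-GRADE lemmas (ref1/ref2)
but NOT tree theorems (the symbol integrality is not a tree fact), so here they are HYPOTHESES spelled
out in full — never asserted, never vendored as facts (D-0026).  With them: AN-1 ∧ AN-S1 ⊢ 19630 and
19630 ∧ AN-S2 ⊢ AN-1, i.e. AN-1 is a reformulation of the analytic crux (the planner's own label,
MEMO-an §4; REF1-AUDIT §3.1.an; REF2-LITMAP §3 «DUP-of-19630, criterion printed»).  Ported verbatim from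
`HOME/an/Sketch.lean` §3 (`analyticMuZeroOnClassX9_of_nonConstancy`, `nonConstancy_of_analyticMuZeroOnClassX9`).

References: [MazurTateTeitelbaum1986Invent] §I.10–I.13; [GreenbergVatsal2000] §3 Prop. (3.7);
[Chakravarthy2024] eqn. (1); HOME MEMO-an.md §3–§4.
-/

-- the summit and its single problem are both named `BirchSwinnertonDyer` (registry layout D-0017)
set_option linter.dupNamespace false

noncomputable section

open scoped Classical MatrixGroups ModularForm

open CongruenceSubgroup WeierstrassCurve Literature.NumberTheory.EllipticCurves
  Literature.NumberTheory.EllipticCurves.ModularForms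
  Summit.BirchSwinnertonDyer.BirchSwinnertonDyer.Rank1Residual
open Literature.NumberTheory.EllipticCurves.Rank1Residual (TeichOrbitNonConstantAt MuAnZeroAt)

namespace Summit.BirchSwinnertonDyer.Rank1Residual.SmallImageMu

/-- **AN-1⁺ ⟹ AN-1**: an X9 pair is `p ≥ 5`, good ordinary, irreducible. [folklore] -/
theorem teichOrbitNonConstancyOnClassX9_of_irreducible (h : TeichOrbitNonConstancyIrreducible) :
    TeichOrbitNonConstancyOnClassX9 := by
  intro W _ _ p _ hX9
  obtain ⟨-, hp, hgood, hord, hirr, -⟩ := id hX9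
  exact h W p hp ⟨hgood, hord⟩ hirr

/-- **AN-1 ∧ AN-S1 ⊢ item 19630** (`AnalyticMuZeroOnClassX9`, verbatim), AN-S1 = «at `p ≥ 5` good
ordinary with `E[p]` irreducible, non-constancy of the orbit sums ⟹ a unit coefficient of `L_p(f,α)`»
taken as the HYPOTHESIS `hS1` (print-grade: MTT (10.1)–(10.2) + GV §3 integrality; not a tree theorem).
Bookkeeping, ported from `HOME/an/Sketch.lean`. [cite: MazurTateTeitelbaum1986Invent, §I.10–I.13] -/
theorem analyticMuZeroOnClassX9_of_teichOrbitNonConstancy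
    (hS1 : ∀ (W : WeierstrassCurve ℚ) [W.IsElliptic] [W.IsGloballyMinimal] (p : ℕ) [Fact p.Prime],
      5 ≤ p → IsOrdinaryAt W p → W.HasIrreducibleModPGaloisRep p →
      TeichOrbitNonConstantAt W p → MuAnZeroAt W p)
    (hA : TeichOrbitNonConstancyOnClassX9) : AnalyticMuZeroOnClassX9 := by
  intro W _ _ p _ N _ f hX9 hf
  obtain ⟨-, hp, hgood, hord, hirr, -⟩ := id hX9
  exact hS1 W p hp ⟨hgood, hord⟩ hirr (hA W p hX9) f hf

/-- **Item 19630 ∧ AN-S2 ⊢ AN-1**, AN-S2 = the converse bridge («a unit coefficient ⟹ non-constancy at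
some level») as the HYPOTHESIS `hS2`: so, modulo the two paper bridges, AN-1 is EQUIVALENT to the
analytic crux 19630 — a reformulation in finite currency, honestly labelled.  Ported from
`HOME/an/Sketch.lean`. [cite: MazurTateTeitelbaum1986Invent, §I.10] -/
theorem teichOrbitNonConstancyOnClassX9_of_analyticMuZeroOnClassX9
    (hS2 : ∀ (W : WeierstrassCurve ℚ) [W.IsElliptic] [W.IsGloballyMinimal] (p : ℕ) [Fact p.Prime],
      5 ≤ p → IsOrdinaryAt W p → W.HasIrreducibleModPGaloisRep p →
      MuAnZeroAt W p → TeichOrbitNonConstantAt W p)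
    (hA : AnalyticMuZeroOnClassX9) : TeichOrbitNonConstancyOnClassX9 := by
  intro W _ _ p _ hX9 N _ f hf
  obtain ⟨-, hp, hgood, hord, hirr, -⟩ := id hX9
  exact hS2 W p hp ⟨hgood, hord⟩ hirr (fun g hg => hA W p g hX9 hg) f hf

end Summit.BirchSwinnertonDyer.Rank1Residual.SmallImageMu

end
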